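import Summits.QuantumFields.YangMills.Theorems.FluctuationComparisonRegPrIntLWregInterior
import HarnessLib

/-!
# CL — THE GOOD FIBRE IS CLOSED INSIDE THE FIBRE: `closure (fibre V ∩ histGood) ⊆ fibre V` (crux `FluctuationComparisonRegPrIntL`,
# stmt-QuantumFields-20520; the kinematic letter «CL(V)» displayed by ✓`FluctuationComparisonRegPrIntLOrbBarOfRegArgminBar` (px17 g14 №6))

Cell `ym3-torus` (YM ladder rung R3 = continuum `SU(2)` Yang–Mills on the three-torus — a RUNG, NOT d = 4, NOT infinite volume, NOT a mass gap, NOT Clay);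
seat `ym-line-cst-p1` g39 (free prover hand); `--supports stmt-QuantumFields-20520 --as helper`, count-neutral, definition-free, default heartbeats.

WHAT.  The descent `D_{J,K} = descendTo F ℰp J K` of the family ([Balaban1987RG1] (0.11): `K − J` block averagings (0.4) by the exp-mean-log operation `ℰp`,
then a re-indexing `fieldShift`) is NOT continuous everywhere — `ℰp` is the measurable total extension of the printed small-loop operation by the value `1`
off its guard (lit `BlockAveragingExpMeanLog`).  It IS continuous at every configuration of the CLOSED small-history window: ✓`continuousAt_iter_of_mem_closure_histGood`
(`…WregInterior` §4c) gives continuity of every intermediate averaging `avg^j`, `j ≤ K − J`, at each `U ∈ closure (histGood F ℰp θ K J)` once the thresholds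
`θ i < δ′` keep the (0.4) loops inside the guard (`((d+2)L)²/4 · δ′ ≤ δ_SU/2`, lit `BlockAveragingPlaquetteBound` ∘ [Balaban1985Averaging] Prop. 2).  Hence:
* §1 `continuousAt_descendTo_of_mem_closure_histGood` — `D_{J,K}` is continuous at every point of `closure histGood`;
  ★`closure_fibre_inter_histGood_subset` — **CL(V)**: `closure (fibre V ∩ histGood) ⊆ fibre V` for EVERY datum `V` and every `J ≤ K` (a limit of good
  histories over `V` still descends to `V`: `D U ∈ closure (D ″ (fibre V ∩ histGood)) ⊆ closure {V} = {V}`);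
  `isClosed_fibre_inter_closure_histGood` / `isCompact_fibre_inter_closure_histGood` — the closed-window fibre `fibre V ∩ closure histGood` is closed, hence compact
  (`SU(2)^{bonds}` is compact), and contains `closure (fibre V ∩ histGood)` (`closure_fibre_inter_histGood_subset_inter`).
* §2 ★★`exists_gamma_closedGoodFibre` — the same FROM A COUPLING in the cell's currency `θ := θBal F.L γ b₀ p₀` ([Balaban1985UV3] (7) p.257 thresholds
  `g_i·p(g_i)`): for every `L`, `0 < b₀`, `0 < p₀` there is `γ₁ ∈ (0, 1]` such that for every family `F` with `F.L = L`, every `0 < γ ≤ γ₁`, every `J ≤ K` and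
  every `V`, CL(V) holds (lit ✓`exists_gamma_forall_θBal_le` makes all thresholds `≤ δ′/2`).  This discharges the `hCL` binder of ✓`orbBar_of_atMostOneCriticalOrbit` /
  ✓`orbBar_one_of_prop7At` in the small-coupling regime, for every datum and depth.

HONEST (CREDIT NOTHING): a kinematic closure lemma composed from landed continuity theorems; nothing of ORB̄ / REG-ARGMIN̄ / MB / Prop. 7 / GAP♭ / GAP♯∘ /
EXW∘ / S2β is proved; the crux `FluctuationComparisonRegPrIntL` (stmt-QuantumFields-20520) is NOT proved; registry №36 untouched; rung R3 = SU(2) YM₃ on T³ —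
NOT d = 4, NOT infinite volume, NOT a mass gap, NOT Clay; `YM3TorusSU2` is NOT proved.  Sorry-free, axioms standard.

References: T. Bałaban, CMP **102** (1985) 255–275 [Balaban1985UV3] ((7) p.257, (41) p.266); CMP **109** (1987) 249–301 [Balaban1987RG1] ((0.4), (0.11) p.253);
CMP **98** (1985) 17–51 [Balaban1985Averaging] (Prop. 2 p.26).
-/

set_option autoImplicit false

noncomputable section

namespace Summit.QuantumFields.YangMills.Theorems.FluctuationComparisonRegPrIntLClosedGoodFibre

open Set Filter Topology
open Literature.MathematicalPhysics.QuantumFieldTheory.Balaban1983to89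
open Literature.MathematicalPhysics.QuantumFieldTheory.Balaban1983to89.T3ContinuumYM3Torus
open Literature.MathematicalPhysics.QuantumFieldTheory.Balaban1983to89.T3UnitLawDensityEML (ℰp)
open Literature.MathematicalPhysics.QuantumFieldTheory.Balaban1983to89.T3UnitScaleTilt
open Literature.MathematicalPhysics.QuantumFieldTheory.Balaban1983to89.T3TiltDescent
open Literature.MathematicalPhysics.QuantumFieldTheory.Balaban1983to89.T3ConstrainedMinimiser (fibre)
open Literature.MathematicalPhysics.QuantumFieldTheory.Balaban1983to89.T3Thresholds
open scoped Literature.MathematicalPhysics.QuantumFieldTheory.Balaban1983to89.T3OrbitAverage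
open Summit.QuantumFields.YangMills.Theorems.FluctuationComparisonRegPrIntLWregInterior (continuousAt_iter_of_mem_closure_histGood)

/-! ## §1 CL under the WREG smallness letters: any threshold profile `θ` with `θ i < δ′`, `((d+2)L)²/4 · δ′ ≤ δ_SU/2` -/

section Generic

variable (F : T3Family) {K : ℕ} {θ : ℕ → ℝ} {δ' : ℝ}

/-- **THE DESCENT `D_{J,K}` IS CONTINUOUS AT EVERY CONFIGURATION OF THE CLOSED SMALL-HISTORY WINDOW** `closure (histGood F ℰp θ K J)`: the `(K−J)`-fold averaging is
(✓`continuousAt_iter_of_mem_closure_histGood`) and the re-indexing `fieldShift` is a coordinate permutation. [cite: Balaban1987RG1, (0.11) p.253; Balaban1985Averaging, Prop. 2 p.26] -/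
theorem continuousAt_descendTo_of_mem_closure_histGood (hδ' : 0 ≤ δ') (hθ : ∀ i, θ i < δ')
    (hsmall : (((((F.P K).d + 2) * (F.P K).L : ℕ) : ℝ) ^ 2 / 4) * δ' ≤ ExpMeanLog.deltaSU (Fin 2) / 2)
    {J : ℕ} (hJK : J ≤ K) {U : GaugeField (F.P K) 0 (Matrix.specialUnitaryGroup (Fin 2) ℂ)} (hU : U ∈ closure (histGood F ℰp θ K J)) :
    ContinuousAt (descendTo F ℰp J K hJK) U := by
  have hiter := continuousAt_iter_of_mem_closure_histGood F hδ' hθ hsmall hJK hU (j := K - J) le_rfl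
  have hshift : Continuous (T3LevelShift.fieldShift (G := Matrix.specialUnitaryGroup (Fin 2) ℂ)
      (F.sitesPerDir_eq (m := F.m) (K := J) (j := 0) (m' := F.m) (K' := K) (j' := K - J) (by omega))) :=
    continuous_pi fun _ => continuous_apply _
  exact hshift.continuousAt.comp hiter

/-- ★ **CL(V) — THE GOOD FIBRE IS CLOSED INSIDE THE FIBRE**: `closure (fibre V ∩ histGood) ⊆ fibre V` for every datum `V` and every `J ≤ K`: a limit `U` of fine
histories over `V` with UV-small history lies in the closed window, where `D_{J,K}` is continuous, so `D_{J,K} U ∈ closure {V} = {V}`.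
[cite: Balaban1985UV3, (7) p.257 and (41) p.266; Balaban1987RG1, (0.11) p.253] -/
theorem closure_fibre_inter_histGood_subset (hδ' : 0 ≤ δ') (hθ : ∀ i, θ i < δ')
    (hsmall : (((((F.P K).d + 2) * (F.P K).L : ℕ) : ℝ) ^ 2 / 4) * δ' ≤ ExpMeanLog.deltaSU (Fin 2) / 2)
    {J : ℕ} (hJK : J ≤ K) (V : GaugeField (F.P J) 0 (Matrix.specialUnitaryGroup (Fin 2) ℂ)) :
    closure (fibre F ℰp J K hJK V ∩ histGood F ℰp θ K J) ⊆ fibre F ℰp J K hJK V := by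
  intro U hU
  have hUg : U ∈ closure (histGood F ℰp θ K J) := closure_mono Set.inter_subset_right hU
  have hca := continuousAt_descendTo_of_mem_closure_histGood F hδ' hθ hsmall hJK hUg
  have hmem : descendTo F ℰp J K hJK U ∈ closure (descendTo F ℰp J K hJK '' (fibre F ℰp J K hJK V ∩ histGood F ℰp θ K J)) :=
    hca.continuousWithinAt.mem_closure_image hU
  have hsub : descendTo F ℰp J K hJK '' (fibre F ℰp J K hJK V ∩ histGood F ℰp θ K J) ⊆ {V} := by
    rintro _ ⟨W, hW, rfl⟩
    exact hW.1
  have hV : descendTo F ℰp J K hJK U ∈ closure ({V} : Set (GaugeField (F.P J) 0 (Matrix.specialUnitaryGroup (Fin 2) ℂ))) :=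
    closure_mono hsub hmem
  rw [closure_singleton] at hV
  exact hV

/-- `closure (fibre V ∩ histGood) ⊆ fibre V ∩ closure histGood` (CL plus monotonicity of the closure). [cite: Balaban1985UV3, (7) p.257 and (41) p.266] -/
theorem closure_fibre_inter_histGood_subset_inter (hδ' : 0 ≤ δ') (hθ : ∀ i, θ i < δ')
    (hsmall : (((((F.P K).d + 2) * (F.P K).L : ℕ) : ℝ) ^ 2 / 4) * δ' ≤ ExpMeanLog.deltaSU (Fin 2) / 2)
    {J : ℕ} (hJK : J ≤ K) (V : GaugeField (F.P J) 0 (Matrix.specialUnitaryGroup (Fin 2) ℂ)) :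
    closure (fibre F ℰp J K hJK V ∩ histGood F ℰp θ K J) ⊆ fibre F ℰp J K hJK V ∩ closure (histGood F ℰp θ K J) :=
  subset_inter (closure_fibre_inter_histGood_subset F hδ' hθ hsmall hJK V) (closure_mono Set.inter_subset_right)

/-- **THE CLOSED-WINDOW FIBRE `fibre V ∩ closure histGood` IS CLOSED** (the descent is continuous on the closed window, so the fibre meets it in a closed set).
[cite: Balaban1985UV3, (7) p.257 and (41) p.266; Balaban1987RG1, (0.11) p.253] -/
theorem isClosed_fibre_inter_closure_histGood (hδ' : 0 ≤ δ') (hθ : ∀ i, θ i < δ')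
    (hsmall : (((((F.P K).d + 2) * (F.P K).L : ℕ) : ℝ) ^ 2 / 4) * δ' ≤ ExpMeanLog.deltaSU (Fin 2) / 2)
    {J : ℕ} (hJK : J ≤ K) (V : GaugeField (F.P J) 0 (Matrix.specialUnitaryGroup (Fin 2) ℂ)) :
    IsClosed (fibre F ℰp J K hJK V ∩ closure (histGood F ℰp θ K J)) := by
  have hcont : ContinuousOn (descendTo F ℰp J K hJK) (closure (histGood F ℰp θ K J)) := fun U hU =>
    (continuousAt_descendTo_of_mem_closure_histGood F hδ' hθ hsmall hJK hU).continuousWithinAt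
  have h := hcont.preimage_isClosed_of_isClosed isClosed_closure (isClosed_singleton (x := V))
  have hset : fibre F ℰp J K hJK V ∩ closure (histGood F ℰp θ K J) = closure (histGood F ℰp θ K J) ∩ descendTo F ℰp J K hJK ⁻¹' {V} := by
    ext U
    simp only [fibre, Set.mem_inter_iff, Set.mem_setOf_eq, Set.mem_preimage, Set.mem_singleton_iff]
    exact and_comm
  rw [hset]
  exact h

/-- … hence COMPACT (`SU(2)^{bonds}` is compact). [cite: Balaban1985UV3, (7) p.257 and (41) p.266] -/
theorem isCompact_fibre_inter_closure_histGood (hδ' : 0 ≤ δ') (hθ : ∀ i, θ i < δ')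
    (hsmall : (((((F.P K).d + 2) * (F.P K).L : ℕ) : ℝ) ^ 2 / 4) * δ' ≤ ExpMeanLog.deltaSU (Fin 2) / 2)
    {J : ℕ} (hJK : J ≤ K) (V : GaugeField (F.P J) 0 (Matrix.specialUnitaryGroup (Fin 2) ℂ)) :
    IsCompact (fibre F ℰp J K hJK V ∩ closure (histGood F ℰp θ K J)) :=
  (isClosed_fibre_inter_closure_histGood F hδ' hθ hsmall hJK V).isCompact

/-- The closure of the good fibre is a compact subset of the fibre's closed window (for minimisation arguments over `closure (fibre V ∩ histGood)`).
[cite: Balaban1985UV3, (7) p.257 and (41) p.266] -/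
theorem isCompact_closure_fibre_inter_histGood {J : ℕ} (hJK : J ≤ K) (V : GaugeField (F.P J) 0 (Matrix.specialUnitaryGroup (Fin 2) ℂ)) :
    IsCompact (closure (fibre F ℰp J K hJK V ∩ histGood F ℰp θ K J)) :=
  isClosed_closure.isCompact

end Generic

/-! ## §2 CL from a coupling, in the cell's currency `θ := θBal F.L γ b₀ p₀` -/

section Regime

/-- ★★ **CL FROM A COUPLING**: for every `L`, `0 < b₀`, `0 < p₀` there is `γ₁ ∈ (0, 1]` such that for every family `F` with `F.L = L`, every `0 < γ ≤ γ₁`, every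
`J ≤ K` and every datum `V`: `closure (fibre V ∩ histGood F ℰp (θBal F.L γ b₀ p₀) K J) ⊆ fibre V` — the `hCL` letter of ✓`orbBar_of_atMostOneCriticalOrbit`,
for every datum and depth (all thresholds `θBal ≤ δ′/2` with `((3+2)L)²/4 · δ′ ≤ δ_SU/2`, ✓`exists_gamma_forall_θBal_le`). [cite: Balaban1985UV3, (7) p.257 and (41) p.266] -/
theorem exists_gamma_closedGoodFibre (L : ℕ) {b₀ p₀ : ℝ} (hb : 0 < b₀) (hp : 0 < p₀) :
    ∃ γ₁ : ℝ, 0 < γ₁ ∧ γ₁ ≤ 1 ∧ ∀ (F : T3Family) (γ : ℝ), F.L = L → 0 < γ → γ ≤ γ₁ →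
      ∀ (J K : ℕ) (hJK : J ≤ K) (V : GaugeField (F.P J) 0 (Matrix.specialUnitaryGroup (Fin 2) ℂ)),
        closure (fibre F ℰp J K hJK V ∩ histGood F ℰp (θBal F.L γ b₀ p₀) K J) ⊆ fibre F ℰp J K hJK V := by
  set δ₁ : ℝ := ExpMeanLog.deltaSU (Fin 2) / 2 / ((((3 + 2) * L : ℕ) : ℝ) ^ 2 / 4 + 1) with hδ₁def
  have hD : 0 < ((((3 + 2) * L : ℕ) : ℝ) ^ 2 / 4 + 1) := by positivity
  have hδ₁ : 0 < δ₁ := by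
    rw [hδ₁def]; exact div_pos (half_pos ExpMeanLog.deltaSU_pos) hD
  obtain ⟨γ₁, hγ₁, hγ₁1, hθ⟩ := exists_gamma_forall_θBal_le (b₀ := b₀) (p₀ := p₀) hb hp (half_pos hδ₁)
  refine ⟨γ₁, hγ₁, hγ₁1, fun F γ hFL hγ hγγ₁ J K hJK V => ?_⟩
  have hL : 1 ≤ F.L := F.hL.2.le
  subst hFL
  have hθ₁ : ∀ i, θBal F.L γ b₀ p₀ i < δ₁ := fun i => (hθ F.L hL γ hγ hγγ₁ i).trans_lt (half_lt_self hδ₁)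
  have hsmall : (((((F.P K).d + 2) * (F.P K).L : ℕ) : ℝ) ^ 2 / 4) * δ₁ ≤ ExpMeanLog.deltaSU (Fin 2) / 2 := by
    have hd : (F.P K).d = 3 := T3Family.P_d F K
    have hLL : (F.P K).L = F.L := rfl
    rw [hd, hLL, hδ₁def]
    rw [mul_div_assoc', div_le_iff₀ hD]
    have hq : 0 ≤ ExpMeanLog.deltaSU (Fin 2) / 2 := (half_pos ExpMeanLog.deltaSU_pos).le
    nlinarith [hq]
  exact closure_fibre_inter_histGood_subset F hδ₁.le hθ₁ hsmall hJK V

/-- ★★ The same package from a coupling with the closed-window facts alongside: CL(V), the closed-window fibre is closed and compact, and `D_{J,K}` is continuous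
on `closure histGood` — for every datum and depth. [cite: Balaban1985UV3, (7) p.257 and (41) p.266; Balaban1987RG1, (0.11) p.253] -/
theorem exists_gamma_closedGoodFibre_package (L : ℕ) {b₀ p₀ : ℝ} (hb : 0 < b₀) (hp : 0 < p₀) :
    ∃ γ₁ : ℝ, 0 < γ₁ ∧ γ₁ ≤ 1 ∧ ∀ (F : T3Family) (γ : ℝ), F.L = L → 0 < γ → γ ≤ γ₁ →
      ∀ (J K : ℕ) (hJK : J ≤ K),
        (∀ U ∈ closure (histGood F ℰp (θBal F.L γ b₀ p₀) K J), ContinuousAt (descendTo F ℰp J K hJK) U) ∧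
        ∀ V : GaugeField (F.P J) 0 (Matrix.specialUnitaryGroup (Fin 2) ℂ),
          closure (fibre F ℰp J K hJK V ∩ histGood F ℰp (θBal F.L γ b₀ p₀) K J) ⊆ fibre F ℰp J K hJK V ∧
          IsClosed (fibre F ℰp J K hJK V ∩ closure (histGood F ℰp (θBal F.L γ b₀ p₀) K J)) ∧
          IsCompact (fibre F ℰp J K hJK V ∩ closure (histGood F ℰp (θBal F.L γ b₀ p₀) K J)) := by
  set δ₁ : ℝ := ExpMeanLog.deltaSU (Fin 2) / 2 / ((((3 + 2) * L : ℕ) : ℝ) ^ 2 / 4 + 1) with hδ₁def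
  have hD : 0 < ((((3 + 2) * L : ℕ) : ℝ) ^ 2 / 4 + 1) := by positivity
  have hδ₁ : 0 < δ₁ := by
    rw [hδ₁def]; exact div_pos (half_pos ExpMeanLog.deltaSU_pos) hD
  obtain ⟨γ₁, hγ₁, hγ₁1, hθ⟩ := exists_gamma_forall_θBal_le (b₀ := b₀) (p₀ := p₀) hb hp (half_pos hδ₁)
  refine ⟨γ₁, hγ₁, hγ₁1, fun F γ hFL hγ hγγ₁ J K hJK => ?_⟩
  have hL : 1 ≤ F.L := F.hL.2.le
  subst hFL
  have hθ₁ : ∀ i, θBal F.L γ b₀ p₀ i < δ₁ := fun i => (hθ F.L hL γ hγ hγγ₁ i).trans_lt (half_lt_self hδ₁)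
  have hsmall : (((((F.P K).d + 2) * (F.P K).L : ℕ) : ℝ) ^ 2 / 4) * δ₁ ≤ ExpMeanLog.deltaSU (Fin 2) / 2 := by
    have hd : (F.P K).d = 3 := T3Family.P_d F K
    have hLL : (F.P K).L = F.L := rfl
    rw [hd, hLL, hδ₁def]
    rw [mul_div_assoc', div_le_iff₀ hD]
    have hq : 0 ≤ ExpMeanLog.deltaSU (Fin 2) / 2 := (half_pos ExpMeanLog.deltaSU_pos).le
    nlinarith [hq]
  exact ⟨fun U hU => continuousAt_descendTo_of_mem_closure_histGood F hδ₁.le hθ₁ hsmall hJK hU, fun V =>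
    ⟨closure_fibre_inter_histGood_subset F hδ₁.le hθ₁ hsmall hJK V, isClosed_fibre_inter_closure_histGood F hδ₁.le hθ₁ hsmall hJK V,
      isCompact_fibre_inter_closure_histGood F hδ₁.le hθ₁ hsmall hJK V⟩⟩

end Regime

end Summit.QuantumFields.YangMills.Theorems.FluctuationComparisonRegPrIntLClosedGoodFibre

end
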